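import Summits.Ventures.HSemireg.Pad4TowerLineDesignCert8Data

/-!
# Pad4Tower ∕ LineDesignCert8 — KERNEL CERTIFICATE: the ◇₈ ceiling-line design ⟨P[6I+ℓ₋₁]⁴⟩ IS an H₁-static G₁-closed support (LINE 6 «ceiling-line game», P-L6-4K dry run; negation lens g6)

HONEST FRAMING. Lens seat `plan-lens-HodgeAV-negation` g6 (director-hodge req-36; R19.2 (3) «fix the transcription format (P-L6-4K) before the
h = 12 row fires»), crux of record stmt-HodgeConjecture-18881 `BlochSeedDiscOne` (skeleton `Lines/birth.lean` 814a6a70c14e831a UNTOUCHED). This file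
is a KERNEL CERTIFICATE ABOUT ONE EXPLICIT FINITE SUPPORT (two `List MCell` literals, 80 `N`-cells + 140 `P`-cells) for the TYPED static families
of record (`Pad4TowerRuleDMu4.RuleDMu4Closed`, `Pad4TowerXresFamilies.XPlusClosed ∕ A2IMinusClosed`, bundled as `Pad4TowerSeedB1.MConfig.StaticH1`),
decided by `decide +kernel` — NO `native_decide`, no `sorry`, no `axiom`, no `instance`, no notation, no Literature fact, no new `def … : Prop`.
NOTHING HERE SAYS THAT HC ∕ HC_CM ∕ HC_AV ∕ H2 ∕ 18881 ∕ (T_h) ∕ (TL_h) HOLDS OR FAILS (HC_CM is a displayed binder of the ladder only). The design is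
EVEN (no odd fully-charged cell, `c8_noOddFC`), so it is CONSISTENT with (T₈) and says nothing about it.

PROVENANCE OF THE SUPPORT (the one machine step — irrelevant to the validity of the certificate: the theorems below hold for the lists AS WRITTEN).
gs-eng-2 g55's RESIDUAL instrument, `pub-hsemireg/general-structure/gs2/g55/residual/models/model-res-FC-P6I+l-1_6I+l-1_6I+l-1_6I+l-1.txt`
(sha16 00eb197d52701ca6; «SAT support for P[6I+ℓ₋₁]⁴ present at ◇₁₀», 8 TRUE G₁-orbit variables: `P[4ℓ₋₁|8I|8I|8I]`, `P[2I+3ℓ₋₁|6I+ℓ₋₁|8I|8I]`,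
`N[2I+3ℓ₋₁|8I|8I|8I]`, `P[4I+2ℓ₋₁|4I+2ℓ₋₁|8I|8I]`, `P[4I+2ℓ₋₁|6I+ℓ₋₁|6I+ℓ₋₁|8I]`, `N[4I+2ℓ₋₁|6I+ℓ₋₁|8I|8I]`, `P[6I+ℓ₋₁]⁴`, `N[6I+ℓ₋₁|6I+ℓ₋₁|6I+ℓ₋₁|8I]`),
expanded under G₁ = ⟨Δ⟩ × S₄ and transcribed letter by letter with the anomaly lens's dictionary of record (`ideators/plan-lens-HodgeAV-anomaly/a9/
mirror_peel.py` 56fa14f9d46397e6 `parse_letter`: `t·I + c·ℓ_φ ↦ (t + c, c·Re φ, c·Im φ)` with `ℓ₁, ℓ_i, ℓ₋₁, ℓ₋ᵢ ↦ (1,0), (0,−1), (−1,0), (0,1)` = the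
tree's `diamondLetter t c k`, `k = 0,1,2,3`) by the lens's `cert/gen_cert.py` + `cert/make_cert8.py`. EVERY letter of the support lies ON THE CEILING
LINE `α + c = 8` (`c8_onLine`) — it is a LINE DESIGN of height 8 in the sense of LINE 6 (`CeilingLineGame.LineSupport 8`, restated here by shape since
crux workfiles do not import each other), found by the solver inside ◇₁₀.

WHAT IS CERTIFIED (all kernel, §3–§4): `c8.InDiamond 8` · every letter on the line `α + c = 8` · `c8.G1Closed` (S₄ via the six transpositions and
`Pad4TowerPermWindow.permClosed_of_swapClosed`, Δ on both levels) · `RuleDMu4Closed c8` (RULE D (μ₄, M) at all 220 cells, chunked) · `XPlusClosed c8`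
(through the literal dual `c8d = c8.dual 0`, `c8_dual_eq`, and the guarded-quantifier form `xresXClosed_iff_guarded`) · `A2IMinusClosed c8` (guarded
form `xresA2IClosed_iff_guarded`) ⇒ **`c8_staticH1 : c8.StaticH1`**; `¬ c8.HasOddFC`; `P[6I+ℓ₋₁]⁴ ∈ c8.upper`.
CONSEQUENCES (§5, kernel): **`cu_cellRealisable : CellRealisable 8 false cuCell`** (`Pad4TowerB1OddBoostBlind.CellRealisable`; hence at every
`h ≥ 8`, `cu_cellRealisable_ge`) — the machine datum «`P[6I+ℓ]⁴` SAT at ◇₈» (◇₈ r3 j305149; g55 `residual/h8/census.json`) used e.g. in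
idea-crit-6 memo-40 V is now a KERNEL fact; **`diagUnitRealisable_eight_six : DiagUnitRealisable 8 6`** (`Pad4TowerB1OddSpanControl`, there a
machine reading) and its boosts; **`staticDeltaSupportWithRealFC : StaticDeltaSupportWithRealFC`** (`Pad4TowerStaticTorus`: «a named MACHINE support
… entering one is a decide of RuleDMu4Closed on ≈ 318 cells — not attempted in this tree») is DISCHARGED, hence by control's (σ-T)
(`Pad4TowerTorusBlind.not_seedB1OddDiamond8DeltaH1_of_witness`) **`not_seedB1OddDiamond8DeltaH1 : ¬ SeedB1OddDiamond8DeltaH1` UNCONDITIONALLY** —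
the Δ-only weakening of (T₈) is REFUTED IN THE KERNEL (reading R14.15 (i): S₄-closure is load-bearing in `SeedB1OddDiamond8G1H1`; before this file
that negative rested on an un-entered machine witness).

P-L6-4K (the transcription format this dry run fixes): a W-LINE-h SAT model ↦ the same four list literals (support + literal dual) ↦ the same
decides, chunked ≈ 16–35 heads per theorem (measured here: RULE D ≈ 1 s per `N`-cell ∕ 0.5 s per `P`-cell, guarded X⁺ ≈ 1.3 s and guarded A2I⁻
≈ 1.5 s per head at 220 cells; cost per head ∝ support size) ↦ `StaticH1` + `G1Closed` + ◇_h + line + the odd FC cell's membership ↦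
`¬ SeedB1OddLine h` by LINE 6's doors. Nothing here is a σ, a seed or a census row.

FILE LAYOUT (tree re-cut of the landready bytes f18b32005834f8f5, filer control g4 per director-hodge R19.12 (2); mechanical: the four list literals of §2
live in the statement-only module `Pad4TowerLineDesignCert8Data`, imported here; one-line docstrings added where the gate requires them; every name,
statement, proof and `set_option` is UNCHANGED, so the Cruxes-level twin `CeilingLineCert8.lean` c765975c14cb1995 and its copy-check carry over
declaration by declaration).
-/

set_option linter.dupNamespace false

namespace Summit.Ventures.HSemireg.Pad4Tower.LineDesignCert8

open Summit.Ventures.HSemireg Summit.Ventures.HSemireg.Pad4Tower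

/-! ## §1 Generic reductions (logic only) -/

/-- the `X` family in GUARDED form: partner and sibling guards hoisted in front of the remaining conjuncts (same statement; the kernel then
enumerates `(Z, σ, u, q)` and `(w, n)` instead of all triples × 256). -/
theorem xresXClosed_iff_guarded (D : MConfig) : XresXClosed D ↔
    ∀ Z ∈ D.lower, ∀ σ u : Fin 4, ∀ q ∈ D.upper, UPartner Z q σ u → ∀ w : Fin 4, ∀ n ∈ D.lower, Sibling q n σ w →
      ∀ f : Fin 4, ¬ XresXFires D Z q n σ u w f := by
  constructor
  · intro h Z hZ σ u q hq _ w n hn _ f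
    exact h Z hZ q hq n hn σ u w f
  · intro h Z hZ q hq n hn σ u w f hF
    exact h Z hZ σ u q hq hF.2.2.1 w n hn hF.2.2.2.2.2.1 f hF

/-- the `A2I` family in GUARDED form (direction, partner and server guards hoisted). -/
theorem xresA2IClosed_iff_guarded (D : MConfig) : XresA2IClosed D ↔
    ∀ Z ∈ D.lower, ∀ σ u : Fin 4, EncDir (Z σ) u → ∀ q ∈ D.upper, UPartner Z q σ u → ∀ f' v : Fin 4, ∀ N' ∈ D.lower,
      UPartner N' q f' v → ¬ XresA2IFires D Z q N' σ u f' v := by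
  constructor
  · intro h Z hZ σ u _ q hq _ f' v N' hN _
    exact h Z hZ q hq N' hN σ u f' v
  · intro h Z hZ q hq N' hN σ u f' v hF
    exact h Z hZ σ u hF.2.1 q hq hF.2.2.1 f' v N' hN hF.2.2.2.2.2.1 hF

/-! ## §2 The support — see `Pad4TowerLineDesignCert8Data` (`l8N`, `l8P`, `l8Pd`, `l8Nd`); here: the levels as `Finset`s and the design -/

set_option maxRecDepth 32768
set_option synthInstance.maxSize 8192
set_option synthInstance.maxHeartbeats 2000000
set_option maxHeartbeats 8000000

/-- `l8N_nodup` — kernel check by `decide`: l8N.Nodup -/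
theorem l8N_nodup : l8N.Nodup := by decide +kernel
/-- `l8P_nodup` — kernel check by `decide`: l8P.Nodup -/
theorem l8P_nodup : l8P.Nodup := by decide +kernel
/-- `l8Pd_nodup` — kernel check by `decide`: l8Pd.Nodup -/
theorem l8Pd_nodup : l8Pd.Nodup := by decide +kernel
/-- `l8Nd_nodup` — kernel check by `decide`: l8Nd.Nodup -/
theorem l8Nd_nodup : l8Nd.Nodup := by decide +kernel

/-- the levels as `Finset`s WITHOUT re-deduplication (the lists are `Nodup`), so that every bounded quantifier is a plain list scan. -/
def s8N : Finset MCell := ⟨↑l8N, by simpa using l8N_nodup⟩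
/-- see `s8N`. -/
def s8P : Finset MCell := ⟨↑l8P, by simpa using l8P_nodup⟩
/-- see `s8N`. -/
def s8Pd : Finset MCell := ⟨↑l8Pd, by simpa using l8Pd_nodup⟩
/-- see `s8N`. -/
def s8Nd : Finset MCell := ⟨↑l8Nd, by simpa using l8Nd_nodup⟩

/-- **THE DESIGN** `c8 = ⟨80 N-cells, 140 P-cells⟩`. -/
def c8 : MConfig := ⟨s8N, s8P⟩
/-- its dual-0 world, as literals (`c8_dual_eq`). -/
def c8d : MConfig := ⟨s8Pd, s8Nd⟩
/-- the certified cell `P[6I+ℓ₋₁]⁴` (= `Pad4TowerB1OddSpanControl.diagUnit 6 2`, `cu_eq_diagUnit`). -/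
def cuCell : MCell := mcellOf (7, -1, 0) (7, -1, 0) (7, -1, 0) (7, -1, 0)

/-- `l8_lengths` — kernel check by `decide`: l8N.length = 80 ∧ l8P.length = 140 ∧ l8Pd.length = 140 ∧ l8Nd.length = 80 -/
theorem l8_lengths : l8N.length = 80 ∧ l8P.length = 140 ∧ l8Pd.length = 140 ∧ l8Nd.length = 80 := by
  refine ⟨?_, ?_, ?_, ?_⟩ <;> decide +kernel

/-! ## §3 The kernel decides -/

/-- `l8N_inDiamond` — kernel check by `decide`: ∀ Z ∈ l8N, MCell.InDiamond 8 Z -/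
theorem l8N_inDiamond : ∀ Z ∈ l8N, MCell.InDiamond 8 Z := by decide +kernel
/-- `l8P_inDiamond` — kernel check by `decide`: ∀ P ∈ l8P, MCell.InDiamond 8 P -/
theorem l8P_inDiamond : ∀ P ∈ l8P, MCell.InDiamond 8 P := by decide +kernel
/-- `l8N_onLine` — kernel check by `decide`: ∀ Z ∈ l8N, ∀ f, OnCeiling 8 (Z f) -/
theorem l8N_onLine : ∀ Z ∈ l8N, ∀ f, OnCeiling 8 (Z f) := by decide +kernel
/-- `l8P_onLine` — kernel check by `decide`: ∀ P ∈ l8P, ∀ f, OnCeiling 8 (P f) -/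
theorem l8P_onLine : ∀ P ∈ l8P, ∀ f, OnCeiling 8 (P f) := by decide +kernel
/-- `s8N_deltaClosed` — kernel check by `decide`: DeltaClosed s8N -/
theorem s8N_deltaClosed : DeltaClosed s8N := by decide +kernel
/-- `s8P_deltaClosed` — kernel check by `decide`: DeltaClosed s8P -/
theorem s8P_deltaClosed : DeltaClosed s8P := by decide +kernel
/-- `s8N_swapClosed` — kernel check by `decide`: ∀ x y : Fin 4, x ≠ y → ∀ Z ∈ s8N, Z.perm (Equiv.swap x y) ∈ s8N -/
theorem s8N_swapClosed : ∀ x y : Fin 4, x ≠ y → ∀ Z ∈ s8N, Z.perm (Equiv.swap x y) ∈ s8N := by decide +kernel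
/-- `s8P_swapClosed` — kernel check by `decide`: ∀ x y : Fin 4, x ≠ y → ∀ Z ∈ s8P, Z.perm (Equiv.swap x y) ∈ s8P -/
theorem s8P_swapClosed : ∀ x y : Fin 4, x ≠ y → ∀ Z ∈ s8P, Z.perm (Equiv.swap x y) ∈ s8P := by decide +kernel
/-- `c8_dual_lower` — kernel check by `decide`: s8P.image (dualCell 0) = s8Pd -/
theorem c8_dual_lower : s8P.image (dualCell 0) = s8Pd := by decide +kernel
/-- `c8_dual_upper` — kernel check by `decide`: s8N.image (dualCell 0) = s8Nd -/
theorem c8_dual_upper : s8N.image (dualCell 0) = s8Nd := by decide +kernel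
/-- the dual-0 world of `c8` IS the literal `c8d`. -/
theorem c8_dual_eq : c8.dual 0 = c8d := congrArg₂ MConfig.mk c8_dual_lower c8_dual_upper
/-- `cu_mem` — kernel check by `decide`: cuCell ∈ l8P -/
theorem cu_mem : cuCell ∈ l8P := by decide +kernel
/-- `cu_fc` — kernel check by `decide`: FCc cuCell ∧ cuCell.pat = 0 -/
theorem cu_fc : FCc cuCell ∧ cuCell.pat = 0 := by constructor <;> decide +kernel
/-- `cu_eq_diagUnit` — kernel check by `decide`: diagUnit 6 2 = cuCell -/
theorem cu_eq_diagUnit : diagUnit 6 2 = cuCell := by decide +kernel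
/-- `c8_noOddFC_N` — kernel check by `decide`: ∀ Z ∈ l8N, ¬ (FCc Z ∧ OddPat Z.pat) -/
theorem c8_noOddFC_N : ∀ Z ∈ l8N, ¬ (FCc Z ∧ OddPat Z.pat) := by decide +kernel
/-- `c8_noOddFC_P` — kernel check by `decide`: ∀ P ∈ l8P, ¬ (FCc P ∧ OddPat P.pat) -/
theorem c8_noOddFC_P : ∀ P ∈ l8P, ¬ (FCc P ∧ OddPat P.pat) := by decide +kernel

/-! RULE D (μ₄, M), cells chunked -/

/-- `ruleDN_1` — kernel check by `decide`: ∀ Z ∈ l8N_1, RuleDMu4N c8 Z -/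
theorem ruleDN_1 : ∀ Z ∈ l8N_1, RuleDMu4N c8 Z := by decide +kernel
/-- `ruleDN_2` — kernel check by `decide`: ∀ Z ∈ l8N_2, RuleDMu4N c8 Z -/
theorem ruleDN_2 : ∀ Z ∈ l8N_2, RuleDMu4N c8 Z := by decide +kernel
/-- `ruleDN_3` — kernel check by `decide`: ∀ Z ∈ l8N_3, RuleDMu4N c8 Z -/
theorem ruleDN_3 : ∀ Z ∈ l8N_3, RuleDMu4N c8 Z := by decide +kernel
/-- `ruleDN_4` — kernel check by `decide`: ∀ Z ∈ l8N_4, RuleDMu4N c8 Z -/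
theorem ruleDN_4 : ∀ Z ∈ l8N_4, RuleDMu4N c8 Z := by decide +kernel
/-- `ruleDN_5` — kernel check by `decide`: ∀ Z ∈ l8N_5, RuleDMu4N c8 Z -/
theorem ruleDN_5 : ∀ Z ∈ l8N_5, RuleDMu4N c8 Z := by decide +kernel
/-- `ruleDP_1` — kernel check by `decide`: ∀ P ∈ l8P_1, RuleDMu4P c8 P -/
theorem ruleDP_1 : ∀ P ∈ l8P_1, RuleDMu4P c8 P := by decide +kernel
/-- `ruleDP_2` — kernel check by `decide`: ∀ P ∈ l8P_2, RuleDMu4P c8 P -/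
theorem ruleDP_2 : ∀ P ∈ l8P_2, RuleDMu4P c8 P := by decide +kernel
/-- `ruleDP_3` — kernel check by `decide`: ∀ P ∈ l8P_3, RuleDMu4P c8 P -/
theorem ruleDP_3 : ∀ P ∈ l8P_3, RuleDMu4P c8 P := by decide +kernel
/-- `ruleDP_4` — kernel check by `decide`: ∀ P ∈ l8P_4, RuleDMu4P c8 P -/
theorem ruleDP_4 : ∀ P ∈ l8P_4, RuleDMu4P c8 P := by decide +kernel

/-! guarded X⁺ (the `X` family of the dual-0 world `c8d`), heads chunked -/

/-- `xplus_1` — kernel check by `decide`: ∀ Z ∈ l8Pd_1, ∀ σ u : Fin 4, ∀ q ∈ s8Nd, UPartner Z q σ u → ∀ w : Fin 4, ∀ n ∈ s8Pd, Sibling q n σ w → ∀ f : Fin 4, ¬ XresXFires c8d Z q n σ u w f -/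
theorem xplus_1 : ∀ Z ∈ l8Pd_1, ∀ σ u : Fin 4, ∀ q ∈ s8Nd, UPartner Z q σ u → ∀ w : Fin 4, ∀ n ∈ s8Pd, Sibling q n σ w →
    ∀ f : Fin 4, ¬ XresXFires c8d Z q n σ u w f := by decide +kernel
/-- `xplus_2` — kernel check by `decide`: ∀ Z ∈ l8Pd_2, ∀ σ u : Fin 4, ∀ q ∈ s8Nd, UPartner Z q σ u → ∀ w : Fin 4, ∀ n ∈ s8Pd, Sibling q n σ w → ∀ f : Fin 4, ¬ XresXFires c8d Z q n σ u w f -/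
theorem xplus_2 : ∀ Z ∈ l8Pd_2, ∀ σ u : Fin 4, ∀ q ∈ s8Nd, UPartner Z q σ u → ∀ w : Fin 4, ∀ n ∈ s8Pd, Sibling q n σ w →
    ∀ f : Fin 4, ¬ XresXFires c8d Z q n σ u w f := by decide +kernel
/-- `xplus_3` — kernel check by `decide`: ∀ Z ∈ l8Pd_3, ∀ σ u : Fin 4, ∀ q ∈ s8Nd, UPartner Z q σ u → ∀ w : Fin 4, ∀ n ∈ s8Pd, Sibling q n σ w → ∀ f : Fin 4, ¬ XresXFires c8d Z q n σ u w f -/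
theorem xplus_3 : ∀ Z ∈ l8Pd_3, ∀ σ u : Fin 4, ∀ q ∈ s8Nd, UPartner Z q σ u → ∀ w : Fin 4, ∀ n ∈ s8Pd, Sibling q n σ w →
    ∀ f : Fin 4, ¬ XresXFires c8d Z q n σ u w f := by decide +kernel
/-- `xplus_4` — kernel check by `decide`: ∀ Z ∈ l8Pd_4, ∀ σ u : Fin 4, ∀ q ∈ s8Nd, UPartner Z q σ u → ∀ w : Fin 4, ∀ n ∈ s8Pd, Sibling q n σ w → ∀ f : Fin 4, ¬ XresXFires c8d Z q n σ u w f -/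
theorem xplus_4 : ∀ Z ∈ l8Pd_4, ∀ σ u : Fin 4, ∀ q ∈ s8Nd, UPartner Z q σ u → ∀ w : Fin 4, ∀ n ∈ s8Pd, Sibling q n σ w →
    ∀ f : Fin 4, ¬ XresXFires c8d Z q n σ u w f := by decide +kernel
/-- `xplus_5` — kernel check by `decide`: ∀ Z ∈ l8Pd_5, ∀ σ u : Fin 4, ∀ q ∈ s8Nd, UPartner Z q σ u → ∀ w : Fin 4, ∀ n ∈ s8Pd, Sibling q n σ w → ∀ f : Fin 4, ¬ XresXFires c8d Z q n σ u w f -/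
theorem xplus_5 : ∀ Z ∈ l8Pd_5, ∀ σ u : Fin 4, ∀ q ∈ s8Nd, UPartner Z q σ u → ∀ w : Fin 4, ∀ n ∈ s8Pd, Sibling q n σ w →
    ∀ f : Fin 4, ¬ XresXFires c8d Z q n σ u w f := by decide +kernel
/-- `xplus_6` — kernel check by `decide`: ∀ Z ∈ l8Pd_6, ∀ σ u : Fin 4, ∀ q ∈ s8Nd, UPartner Z q σ u → ∀ w : Fin 4, ∀ n ∈ s8Pd, Sibling q n σ w → ∀ f : Fin 4, ¬ XresXFires c8d Z q n σ u w f -/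
theorem xplus_6 : ∀ Z ∈ l8Pd_6, ∀ σ u : Fin 4, ∀ q ∈ s8Nd, UPartner Z q σ u → ∀ w : Fin 4, ∀ n ∈ s8Pd, Sibling q n σ w →
    ∀ f : Fin 4, ¬ XresXFires c8d Z q n σ u w f := by decide +kernel
/-- `xplus_7` — kernel check by `decide`: ∀ Z ∈ l8Pd_7, ∀ σ u : Fin 4, ∀ q ∈ s8Nd, UPartner Z q σ u → ∀ w : Fin 4, ∀ n ∈ s8Pd, Sibling q n σ w → ∀ f : Fin 4, ¬ XresXFires c8d Z q n σ u w f -/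
theorem xplus_7 : ∀ Z ∈ l8Pd_7, ∀ σ u : Fin 4, ∀ q ∈ s8Nd, UPartner Z q σ u → ∀ w : Fin 4, ∀ n ∈ s8Pd, Sibling q n σ w →
    ∀ f : Fin 4, ¬ XresXFires c8d Z q n σ u w f := by decide +kernel

/-! guarded A2I⁻, heads chunked -/

/-- `a2i_1` — kernel check by `decide`: ∀ Z ∈ l8N_1, ∀ σ u : Fin 4, EncDir (Z σ) u → ∀ q ∈ s8P, UPartner Z q σ u → ∀ f' v : Fin 4, ∀ N' ∈ s8N, UPartner N' q f' v → ¬ XresA2IFires c8 Z q N' σ u f' v -/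
theorem a2i_1 : ∀ Z ∈ l8N_1, ∀ σ u : Fin 4, EncDir (Z σ) u → ∀ q ∈ s8P, UPartner Z q σ u → ∀ f' v : Fin 4, ∀ N' ∈ s8N,
    UPartner N' q f' v → ¬ XresA2IFires c8 Z q N' σ u f' v := by decide +kernel
/-- `a2i_2` — kernel check by `decide`: ∀ Z ∈ l8N_2, ∀ σ u : Fin 4, EncDir (Z σ) u → ∀ q ∈ s8P, UPartner Z q σ u → ∀ f' v : Fin 4, ∀ N' ∈ s8N, UPartner N' q f' v → ¬ XresA2IFires c8 Z q N… -/
theorem a2i_2 : ∀ Z ∈ l8N_2, ∀ σ u : Fin 4, EncDir (Z σ) u → ∀ q ∈ s8P, UPartner Z q σ u → ∀ f' v : Fin 4, ∀ N' ∈ s8N,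
    UPartner N' q f' v → ¬ XresA2IFires c8 Z q N' σ u f' v := by decide +kernel
/-- `a2i_3` — kernel check by `decide`: ∀ Z ∈ l8N_3, ∀ σ u : Fin 4, EncDir (Z σ) u → ∀ q ∈ s8P, UPartner Z q σ u → ∀ f' v : Fin 4, ∀ N' ∈ s8N, UPartner N' q f' v → ¬ XresA2IFires c8 Z q N… -/
theorem a2i_3 : ∀ Z ∈ l8N_3, ∀ σ u : Fin 4, EncDir (Z σ) u → ∀ q ∈ s8P, UPartner Z q σ u → ∀ f' v : Fin 4, ∀ N' ∈ s8N,
    UPartner N' q f' v → ¬ XresA2IFires c8 Z q N' σ u f' v := by decide +kernel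
/-- `a2i_4` — kernel check by `decide`: ∀ Z ∈ l8N_4, ∀ σ u : Fin 4, EncDir (Z σ) u → ∀ q ∈ s8P, UPartner Z q σ u → ∀ f' v : Fin 4, ∀ N' ∈ s8N, UPartner N' q f' v → ¬ XresA2IFires c8 Z q N… -/
theorem a2i_4 : ∀ Z ∈ l8N_4, ∀ σ u : Fin 4, EncDir (Z σ) u → ∀ q ∈ s8P, UPartner Z q σ u → ∀ f' v : Fin 4, ∀ N' ∈ s8N,
    UPartner N' q f' v → ¬ XresA2IFires c8 Z q N' σ u f' v := by decide +kernel
/-- `a2i_5` — kernel check by `decide`: ∀ Z ∈ l8N_5, ∀ σ u : Fin 4, EncDir (Z σ) u → ∀ q ∈ s8P, UPartner Z q σ u → ∀ f' v : Fin 4, ∀ N' ∈ s8N, UPartner N' q f' v → ¬ XresA2IFires c8 Z q N… -/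
theorem a2i_5 : ∀ Z ∈ l8N_5, ∀ σ u : Fin 4, EncDir (Z σ) u → ∀ q ∈ s8P, UPartner Z q σ u → ∀ f' v : Fin 4, ∀ N' ∈ s8N,
    UPartner N' q f' v → ¬ XresA2IFires c8 Z q N' σ u f' v := by decide +kernel

/-! ## §4 Assembly: the design is H₁-static, G₁-closed, in ◇₈, on the ceiling line -/

/-- membership in the levels of `c8` ∕ `c8d` is list membership (no re-deduplication). -/
theorem mem_lower_iff {Z : MCell} : Z ∈ c8.lower ↔ Z ∈ l8N := Iff.rfl
/-- `mem_upper_iff` — assembly (term-level, from the checks above): {P : MCell} : P ∈ c8.upper ↔ P ∈ l8P -/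
theorem mem_upper_iff {P : MCell} : P ∈ c8.upper ↔ P ∈ l8P := Iff.rfl
/-- `mem_dlower_iff` — assembly (term-level, from the checks above): {Z : MCell} : Z ∈ c8d.lower ↔ Z ∈ l8Pd -/
theorem mem_dlower_iff {Z : MCell} : Z ∈ c8d.lower ↔ Z ∈ l8Pd := Iff.rfl
/-- `mem_dupper_iff` — assembly (term-level, from the checks above): {P : MCell} : P ∈ c8d.upper ↔ P ∈ l8Nd -/
theorem mem_dupper_iff {P : MCell} : P ∈ c8d.upper ↔ P ∈ l8Nd := Iff.rfl

/-- `ruleDN_all` — assembly (term-level, from the checks above): ∀ Z ∈ l8N, RuleDMu4N c8 Z -/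
theorem ruleDN_all : ∀ Z ∈ l8N, RuleDMu4N c8 Z := List.forall_mem_append.2 ⟨List.forall_mem_append.2 ⟨List.forall_mem_append.2 ⟨List.forall_mem_append.2 ⟨ruleDN_1, ruleDN_2⟩, ruleDN_3⟩, ruleDN_4⟩, ruleDN_5⟩
/-- `ruleDP_all` — assembly (term-level, from the checks above): ∀ P ∈ l8P, RuleDMu4P c8 P -/
theorem ruleDP_all : ∀ P ∈ l8P, RuleDMu4P c8 P := List.forall_mem_append.2 ⟨List.forall_mem_append.2 ⟨List.forall_mem_append.2 ⟨ruleDP_1, ruleDP_2⟩, ruleDP_3⟩, ruleDP_4⟩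
/-- `xplus_all` — assembly (term-level, from the checks above): ∀ Z ∈ l8Pd, ∀ σ u : Fin 4, ∀ q ∈ s8Nd, UPartner Z q σ u → ∀ w : Fin 4, ∀ n ∈ s8Pd, Sibling q n σ w → ∀ f : Fin 4, ¬ XresXFires c8d Z q n σ u w f -/
theorem xplus_all : ∀ Z ∈ l8Pd, ∀ σ u : Fin 4, ∀ q ∈ s8Nd, UPartner Z q σ u → ∀ w : Fin 4, ∀ n ∈ s8Pd, Sibling q n σ w →
    ∀ f : Fin 4, ¬ XresXFires c8d Z q n σ u w f := List.forall_mem_append.2 ⟨List.forall_mem_append.2 ⟨List.forall_mem_append.2 ⟨List.forall_mem_append.2 ⟨List.forall_mem_append.2 ⟨List.forall_mem_append.2 ⟨xplus_1, xplus_2⟩, xplus_3⟩, xplus_4⟩, xplus_5⟩, xplus_6⟩, xplus_7⟩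
/-- `a2i_all` — assembly (term-level, from the checks above): ∀ Z ∈ l8N, ∀ σ u : Fin 4, EncDir (Z σ) u → ∀ q ∈ s8P, UPartner Z q σ u → ∀ f' v : Fin 4, ∀ N' ∈ s8N, UPartner N' q f' v → ¬ XresA2IFires c8 Z q N' … -/
theorem a2i_all : ∀ Z ∈ l8N, ∀ σ u : Fin 4, EncDir (Z σ) u → ∀ q ∈ s8P, UPartner Z q σ u → ∀ f' v : Fin 4, ∀ N' ∈ s8N,
    UPartner N' q f' v → ¬ XresA2IFires c8 Z q N' σ u f' v := List.forall_mem_append.2 ⟨List.forall_mem_append.2 ⟨List.forall_mem_append.2 ⟨List.forall_mem_append.2 ⟨a2i_1, a2i_2⟩, a2i_3⟩, a2i_4⟩, a2i_5⟩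

/-- **◇₈.** -/
theorem c8_inDiamond : c8.InDiamond 8 := ⟨fun Z hZ => l8N_inDiamond Z hZ, fun P hP => l8P_inDiamond P hP⟩
/-- **on the ceiling line `α + c = 8`** (LINE 6's `LineSupport 8 c8`, by shape). -/
theorem c8_onLine : (∀ Z ∈ c8.lower, ∀ f, OnCeiling 8 (Z f)) ∧ ∀ P ∈ c8.upper, ∀ f, OnCeiling 8 (P f) :=
  ⟨fun Z hZ => l8N_onLine Z hZ, fun P hP => l8P_onLine P hP⟩
/-- **G₁-closed.** -/
theorem c8_g1Closed : c8.G1Closed :=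
  ⟨permClosed_of_swapClosed s8N_swapClosed, permClosed_of_swapClosed s8P_swapClosed, s8N_deltaClosed, s8P_deltaClosed⟩
/-- **RULE D (μ₄, M) closed.** -/
theorem c8_ruleDMu4Closed : RuleDMu4Closed c8 := ⟨fun Z hZ => ruleDN_all Z hZ, fun P hP => ruleDP_all P hP⟩
/-- **X⁺ closed.** -/
theorem c8_xPlusClosed : XPlusClosed c8 := by
  have h : XresXClosed c8d := (xresXClosed_iff_guarded c8d).2 fun Z hZ => xplus_all Z hZ
  show XresXClosed (c8.dual 0)
  rw [c8_dual_eq]; exact h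
/-- **A2I⁻ closed.** -/
theorem c8_a2iMinusClosed : A2IMinusClosed c8 := (xresA2IClosed_iff_guarded c8).2 fun Z hZ => a2i_all Z hZ
/-- **THE DESIGN IS H₁-STATIC.** -/
theorem c8_staticH1 : c8.StaticH1 := ⟨c8_ruleDMu4Closed, c8_xPlusClosed, c8_a2iMinusClosed⟩
/-- it is EVEN: no odd fully-charged cell (consistent with (T₈); says nothing about it). -/
theorem c8_noOddFC : ¬ c8.HasOddFC := by
  rintro (⟨Z, hZ, h⟩ | ⟨P, hP, h⟩)
  · exact c8_noOddFC_N Z hZ h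
  · exact c8_noOddFC_P P hP h
/-- the certified cell is present at level `P`. -/
theorem cu_mem_upper : cuCell ∈ c8.upper := cu_mem

/-! ## §5 Consequences (kernel): three machine data of the tree become theorems -/

/-- **`P[6I+ℓ₋₁]⁴` IS REALISABLE AT ◇₈** (`Pad4TowerB1OddBoostBlind.CellRealisable`; formerly the machine datum «cu8 SAT at ◇₈»). -/
theorem cu_cellRealisable : CellRealisable 8 false cuCell := ⟨c8, c8_inDiamond, c8_g1Closed, c8_staticH1, by simpa using cu_mem_upper⟩
/-- … hence at every height `h ≥ 8`. -/
theorem cu_cellRealisable_ge {h : ℤ} (hh : 8 ≤ h) : CellRealisable h false cuCell := cellRealisable_mono hh cu_cellRealisable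
/-- the LINE-realisable shape (LINE 6 `CeilingLineGame.LineRealisable 8 false cuCell`, unfolded): a static G₁-closed ◇₈ support ON THE LINE carries it. -/
theorem cu_lineRealisable_shape : ∃ C : MConfig, C.InDiamond 8 ∧ ((∀ Z ∈ C.lower, ∀ f, OnCeiling 8 (Z f)) ∧ ∀ P ∈ C.upper, ∀ f, OnCeiling 8 (P f)) ∧
    C.G1Closed ∧ C.StaticH1 ∧ cuCell ∈ C.upper := ⟨c8, c8_inDiamond, c8_onLine, c8_g1Closed, c8_staticH1, cu_mem_upper⟩
/-- every cell of the design is realisable at ◇₈ (at its own level). -/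
theorem c8_cells_realisable : (∀ Z ∈ c8.lower, CellRealisable 8 true Z) ∧ ∀ P ∈ c8.upper, CellRealisable 8 false P :=
  ⟨fun Z hZ => ⟨c8, c8_inDiamond, c8_g1Closed, c8_staticH1, by simpa using hZ⟩,
   fun P hP => ⟨c8, c8_inDiamond, c8_g1Closed, c8_staticH1, by simpa using hP⟩⟩
/-- **`DiagUnitRealisable 8 6`** (`Pad4TowerB1OddSpanControl`; there a machine reading of j298438 ∕ j309715). -/
theorem diagUnitRealisable_eight_six : DiagUnitRealisable 8 6 :=
  ⟨c8, c8_inDiamond, c8_g1Closed, c8_staticH1, 2, by rw [cu_eq_diagUnit]; exact cu_mem_upper⟩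
/-- … at every `h ≥ 8`, together with the boosted unit `[8I+ℓ_u]⁴` two heights up (`Pad4TowerB1OddBoostBlind.diagUnits_next_height_holds`). -/
theorem diagUnitRealisable_ge_six {h : ℤ} (hh : 8 ≤ h) : DiagUnitRealisable h 6 ∧ DiagUnitRealisable (h + 2) 8 :=
  ⟨diagUnitRealisable_mono hh diagUnitRealisable_eight_six, (diagUnits_next_height_holds (diagUnitRealisable_mono hh diagUnitRealisable_eight_six)).2⟩
/-- **`StaticDeltaSupportWithRealFC` DISCHARGED** (`Pad4TowerStaticTorus`: the named machine support «not attempted in this tree»). -/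
theorem staticDeltaSupportWithRealFC : StaticDeltaSupportWithRealFC :=
  ⟨c8, c8_inDiamond, s8N_deltaClosed, s8P_deltaClosed, c8_staticH1, cuCell, Or.inr cu_mem_upper, cu_fc.1, cu_fc.2⟩
/-- **(σ-N) UNCONDITIONAL: THE Δ-ONLY WEAKENING OF (T₈) IS FALSE** — `¬ SeedB1OddDiamond8DeltaH1` in the kernel (control's (σ-T)
`Pad4TowerTorusBlind.not_seedB1OddDiamond8DeltaH1_of_witness` + the witness above): S₄-closure is load-bearing in `SeedB1OddDiamond8G1H1`. -/
theorem not_seedB1OddDiamond8DeltaH1 : ¬ SeedB1OddDiamond8DeltaH1 := not_seedB1OddDiamond8DeltaH1_of_witness staticDeltaSupportWithRealFC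

end Summit.Ventures.HSemireg.Pad4Tower.LineDesignCert8
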